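import Literature.Geometry.Lorentzian.ImmersionChartMetric
import Literature.Geometry.Lorentzian.CoordGaussianSliceMap
import Literature.Geometry.Lorentzian.DataEmbeddingNormalSmooth
import Literature.Geometry.Lorentzian.CauchyDevelopmentOneJet
import Literature.Geometry.Lorentzian.CauchyDevelopmentComap
import Literature.Geometry.Lorentzian.HypersurfaceNaturality
import Literature.Geometry.Lorentzian.ChartSecondFundamentalForm
import HarnessLib

/-!
# The second-order Gaussian chart of a data embedding around a point of the data hypersurface

For a data embedding `𝒮 = (M, g, τ, ι, ν)` of an initial data set `D = (h, k)` on a `3`-manifold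
`X` (`DataEmbedding`, `CauchyDevelopment.lean`), a point `x₀ ∈ X`, the preferred charts
`c = chartAt x₀` of `X` and `ψ = chartAt (ι x₀)` of `M`, and an identification
`cs : E4 ≃L ℝ × E3`, this file builds the coordinate objects consumed by the coordinate KID
calculus (`CoordGaussianSlice.lean`, `CoordKillingCauchyData.lean`):

* `gcΦ₀ : U₀ → M`, `u ↦ ψ⁻¹(cs⁻¹ u)` on `U₀ = cs(ψ.target)` and the components
  `gcG₀ = (Φ₀^* g)` (`ImmersionChart.repr`), smooth, symmetric, nondegenerate on `U₀`;
* the readings `gcP y = cs(ψ(ι(c⁻¹ y)))` of the hypersurface and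
  `gcN y = cs(dψ(ν(c⁻¹ y)))` of its future unit normal on
  `gcB₀ = c.target ∩ (ι ∘ c⁻¹)⁻¹(ψ.source)`, which form a slice reading
  (`isSliceReading`: `G₀(N, N) = g(ν, ν) = −1`, `G₀(N, DP v) = g(ν, dι dc⁻¹ v) = 0`, `DP`
  injective), so that the second-order Gaussian slice map `F̂` of `CoordGaussianSliceMap.lean`
  applies;
* `gcΦ : V → M`, `Φ = Φ₀ ∘ F̂` on the Gaussian domain `V ⊇ {0} × gcB₀` and its components
  `gcG = Φ^* g = F̂^* G₀` (`gcG_eq_pullMetric`): a Gaussian slice (`isGaussianSlice_gcG`) whose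
  induced metric and coordinate second fundamental form are the data read through `c⁻¹`
  (`sliceMetric_gcG`, `sliceK_gcG` — the latter by the naturality of the shape tensor under
  `Φ₀` and under `c⁻¹` and the chart formula `K(v,w) = g(DN v + Γ(N)(DP v), DP w)`), Ricci flat
  when `𝒮` is vacuum (`ricAt_gcG_eq_zero`), slice-hyperbolic at the slice points
  (`isSliceHyperbolic_gcG`), with `Φ(0, y) = ι(c⁻¹ y)` and `dΦ_{(0,y)} e₀ = ν(c⁻¹ y)`.

Everything is proved; the definitions are compositions of charts; no named facts (D-0026).
Wald 1984, §3.3 (Gaussian normal coordinates) and §10.2; O'Neill 1983, Ch. 4.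

## References

* R. M. Wald, *General Relativity*, University of Chicago Press 1984, §3.3, §10.2,
  (10.2.9)–(10.2.13). [Wald1984]
* B. O'Neill, *Semi-Riemannian geometry with applications to relativity*, Academic Press 1983,
  Ch. 3, Prop. 3.59; Ch. 4, Lemma 4.1, Lemma 4.4 ff. [ONeill1983]
-/

noncomputable section

set_option maxSynthPendingDepth 3

open Bundle Set Function Filter TopologicalSpace Manifold
open scoped Manifold ContDiff Topology

namespace Literature.Geometry.Lorentzian

open MetricCoord MetricCoord.GaussSlice

namespace DataEmbedding

universe u

variable {X : Type u} [TopologicalSpace X] [ChartedSpace E3 X] [IsManifold (𝓡 3) ∞ X]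
  [ConnectedSpace X] {D : InitialDataSet (𝓡 3) X} (𝒮 : DataEmbedding D) (x₀ : X)
  (cs : E4 ≃L[ℝ] ℝ × E3)

/-! ### The chart of the spacetime read on `ℝ × E3` -/

/-- The chart domain `U₀ = cs(ψ.target) ⊆ ℝ × E3`, `ψ` the preferred chart at `ι x₀`. [folklore] -/
def gcU₀ : Opens (ℝ × E3) :=
  ⟨cs.symm ⁻¹' (chartAt E4 (𝒮.embed x₀)).target,
    (chartAt E4 (𝒮.embed x₀)).open_target.preimage cs.symm.continuous⟩

/-- The inverse chart `u ↦ ψ⁻¹(cs⁻¹ u)` as a map of all of `ℝ × E3` (junk off `U₀`). [folklore] -/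
def gcΦ₀ext : ℝ × E3 → 𝒮.carrier := fun u ↦ (chartAt E4 (𝒮.embed x₀)).symm (cs.symm u)

/-- The inverse chart on `U₀`. [folklore] -/
def gcΦ₀ : gcU₀ 𝒮 x₀ cs → 𝒮.carrier := fun u ↦ gcΦ₀ext 𝒮 x₀ cs u

/-- Membership in `U₀`. [folklore] -/
theorem mem_gcU₀ {u : ℝ × E3} : u ∈ gcU₀ 𝒮 x₀ cs ↔ cs.symm u ∈ (chartAt E4 (𝒮.embed x₀)).target :=
  Iff.rfl

/-- The extended inverse chart is `C^∞` on `U₀`. [folklore] -/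
theorem contMDiffOn_gcΦ₀ext : ContMDiffOn 𝓘(ℝ, ℝ × E3) (𝓡 4) ∞ (gcΦ₀ext 𝒮 x₀ cs) (gcU₀ 𝒮 x₀ cs) :=
  (contMDiffOn_chart_symm (I := 𝓡 4) (x := 𝒮.embed x₀) (n := ∞)).comp
    cs.symm.contDiff.contMDiff.contMDiffOn fun _ hu ↦ hu

/-- The inverse chart on `U₀` is `C^∞` (stated with the regularity `∞ + 1 = ∞` asked by
`PseudoRiemannianMetric.comap`). [folklore] -/
theorem contMDiff_gcΦ₀ : ContMDiff 𝓘(ℝ, ℝ × E3) (𝓡 4) (∞ + 1) (gcΦ₀ 𝒮 x₀ cs) := by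
  have h : ((∞ : ℕ∞ω) + 1) = ∞ := rfl
  rw [h]
  exact (contMDiffOn_gcΦ₀ext 𝒮 x₀ cs).comp_contMDiff contMDiff_subtype_val fun u ↦ u.2

/-- The differential of the extended inverse chart: `dΦ₀ext_u = d(ψ⁻¹)_{cs⁻¹ u} ∘ cs⁻¹`. [folklore] -/
theorem mfderiv_gcΦ₀ext {u : ℝ × E3} (hu : u ∈ gcU₀ 𝒮 x₀ cs) (a : ℝ × E3) :
    mfderiv 𝓘(ℝ, ℝ × E3) (𝓡 4) (gcΦ₀ext 𝒮 x₀ cs) u a =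
      mfderiv 𝓘(ℝ, E4) (𝓡 4) (chartAt E4 (𝒮.embed x₀)).symm (cs.symm u) (cs.symm a) := by
  have hψ : MDifferentiableAt 𝓘(ℝ, E4) (𝓡 4) (chartAt E4 (𝒮.embed x₀)).symm (cs.symm u) :=
    (mdifferentiable_chart (I := 𝓡 4) (𝒮.embed x₀)).mdifferentiableAt_symm hu
  have hcs : MDifferentiableAt 𝓘(ℝ, ℝ × E3) 𝓘(ℝ, E4) (cs.symm : ℝ × E3 → E4) u :=
    cs.symm.mdifferentiable u
  have h := mfderiv_comp u hψ hcs
  rw [show gcΦ₀ext 𝒮 x₀ cs = (chartAt E4 (𝒮.embed x₀)).symm ∘ (cs.symm : ℝ × E3 → E4) from rfl, h]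
  change mfderiv 𝓘(ℝ, E4) (𝓡 4) (chartAt E4 (𝒮.embed x₀)).symm (cs.symm u)
      (mfderiv 𝓘(ℝ, ℝ × E3) 𝓘(ℝ, E4) (cs.symm : ℝ × E3 → E4) u a) = _
  congr 1
  exact congrArg (fun L : (ℝ × E3) →L[ℝ] E4 ↦ L a) (cs.symm.mfderiv_eq (x := u))

/-- The differential of the inverse chart on `U₀` is that of the extended one. [folklore] -/
theorem mfderiv_gcΦ₀ (u : gcU₀ 𝒮 x₀ cs) :
    mfderiv 𝓘(ℝ, ℝ × E3) (𝓡 4) (gcΦ₀ 𝒮 x₀ cs) u = mfderiv 𝓘(ℝ, ℝ × E3) (𝓡 4) (gcΦ₀ext 𝒮 x₀ cs) u :=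
  (ImmersionChart.mfderiv_ext_eq (Φ := gcΦ₀ 𝒮 x₀ cs) (fun _ ↦ rfl) (contMDiffOn_gcΦ₀ext 𝒮 x₀ cs) u).symm

/-- `d(ψ⁻¹)_{ψ z}(dψ_z w) = w` on the chart source. [folklore] -/
theorem mfderiv_chart_symm_mfderiv_chart {z : 𝒮.carrier} (hz : z ∈ (chartAt E4 (𝒮.embed x₀)).source)
    (w : TangentSpace (𝓡 4) z) :
    mfderiv 𝓘(ℝ, E4) (𝓡 4) (chartAt E4 (𝒮.embed x₀)).symm (chartAt E4 (𝒮.embed x₀) z)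
        (mfderiv (𝓡 4) 𝓘(ℝ, E4) (chartAt E4 (𝒮.embed x₀)) z w) = w := by
  have h := (mdifferentiable_chart (I := 𝓡 4) (𝒮.embed x₀)).symm_comp_deriv hz
  exact congrArg (fun L : TangentSpace (𝓡 4) z →L[ℝ] TangentSpace (𝓡 4) z ↦ L w) h

/-- The differentials of the inverse chart are injective. [folklore] -/
theorem injective_mfderiv_gcΦ₀ :
    ∀ u : gcU₀ 𝒮 x₀ cs, Injective (mfderiv 𝓘(ℝ, ℝ × E3) (𝓡 4) (gcΦ₀ 𝒮 x₀ cs) u) := fun u ↦ by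
  rw [mfderiv_gcΦ₀]
  intro a b h
  have ha := mfderiv_gcΦ₀ext 𝒮 x₀ cs u.2 a
  have hb := mfderiv_gcΦ₀ext 𝒮 x₀ cs u.2 b
  set e := (mdifferentiable_chart (I := 𝓡 4) (𝒮.embed x₀)).symm.mfderiv u.2 with he
  have h' : e (cs.symm a) = e (cs.symm b) := by
    change mfderiv 𝓘(ℝ, E4) (𝓡 4) (chartAt E4 (𝒮.embed x₀)).symm (cs.symm u) (cs.symm a) =
      mfderiv 𝓘(ℝ, E4) (𝓡 4) (chartAt E4 (𝒮.embed x₀)).symm (cs.symm u) (cs.symm b)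
    rw [← ha, ← hb]
    exact h
  exact cs.symm.injective (e.injective h')

/-- `dim (ℝ × E3) = dim E4`. [folklore] -/
theorem finrank_prod_eq : Module.finrank ℝ (ℝ × E3) = Module.finrank ℝ E4 := by
  rw [Module.finrank_prod, Module.finrank_self, finrank_euclideanSpace_fin, finrank_euclideanSpace_fin]

/-- **The metric components in the chart `Φ₀`**: `G₀ = (Φ₀^* g)` read on `ℝ × E3`. [folklore] -/
def gcG₀ : (ℝ × E3) → (ℝ × E3) →L[ℝ] (ℝ × E3) →L[ℝ] ℝ :=
  ImmersionChart.repr 𝒮.metric.toPseudoRiemannianMetric (contMDiff_gcΦ₀ 𝒮 x₀ cs)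
    (injective_mfderiv_gcΦ₀ 𝒮 x₀ cs) finrank_prod_eq

/-- The components are smooth, symmetric and nondegenerate on `U₀`. [folklore] -/
theorem isMetricOn_gcG₀ : IsMetricOn (gcG₀ 𝒮 x₀ cs) (gcU₀ 𝒮 x₀ cs) :=
  ImmersionChart.isMetricOn_repr _ _ _ _

/-- The components at a point of `U₀`: `G₀(u)(a, b) = g_{Φ₀ u}(dΦ₀ext a, dΦ₀ext b)`. [folklore] -/
theorem gcG₀_apply {u : ℝ × E3} (hu : u ∈ gcU₀ 𝒮 x₀ cs) (a b : ℝ × E3) :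
    gcG₀ 𝒮 x₀ cs u a b = 𝒮.metric.val (gcΦ₀ext 𝒮 x₀ cs u)
      (mfderiv 𝓘(ℝ, ℝ × E3) (𝓡 4) (gcΦ₀ext 𝒮 x₀ cs) u a)
      (mfderiv 𝓘(ℝ, ℝ × E3) (𝓡 4) (gcΦ₀ext 𝒮 x₀ cs) u b) := by
  rw [gcG₀, ImmersionChart.repr_apply_of_mem _ _ _ _ hu, ← mfderiv_gcΦ₀ 𝒮 x₀ cs ⟨u, hu⟩]
  rfl

/-! ### The hypersurface and its normal read in the chart -/

/-- The slice parameter domain `B₀ = c.target ∩ (ι ∘ c⁻¹)⁻¹(ψ.source)`. [folklore] -/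
def gcB₀ : Set E3 :=
  (chartAt E3 x₀).target ∩ (fun y ↦ 𝒮.embed ((chartAt E3 x₀).symm y)) ⁻¹' (chartAt E4 (𝒮.embed x₀)).source

/-- The reading of the hypersurface: `P y = cs(ψ(ι(c⁻¹ y)))`. [folklore] -/
def gcP : E3 → ℝ × E3 := fun y ↦ cs (chartAt E4 (𝒮.embed x₀) (𝒮.embed ((chartAt E3 x₀).symm y)))

/-- The reading of the unit normal: `N y = cs(dψ(ν(c⁻¹ y)))` (through the tangent trivialisation
at `ι x₀`). [folklore] -/
def gcN : E3 → ℝ × E3 := fun y ↦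
  cs ((trivializationAt E4 (TangentSpace (𝓡 4) : 𝒮.carrier → Type _) (𝒮.embed x₀))
    (TotalSpace.mk' E4 (𝒮.embed ((chartAt E3 x₀).symm y)) (𝒮.normal ((chartAt E3 x₀).symm y)))).2

/-- `B₀` is open. [folklore] -/
theorem isOpen_gcB₀ : IsOpen (gcB₀ 𝒮 x₀) := by
  have hc : ContinuousOn (fun y ↦ 𝒮.embed ((chartAt E3 x₀).symm y)) (chartAt E3 x₀).target :=
    𝒮.isSmoothEmbedding.contMDiff.continuous.comp_continuousOn (chartAt E3 x₀).continuousOn_symm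
  exact hc.isOpen_inter_preimage (chartAt E3 x₀).open_target (chartAt E4 (𝒮.embed x₀)).open_source

/-- `c x₀ ∈ B₀`. [folklore] -/
theorem chart_mem_gcB₀ : chartAt E3 x₀ x₀ ∈ gcB₀ 𝒮 x₀ :=
  ⟨mem_chart_target _ _, by
    simp only [mem_preimage, OpenPartialHomeomorph.left_inv _ (mem_chart_source E3 x₀)]
    exact mem_chart_source _ _⟩

variable {𝒮 x₀ cs}

/-- The hypersurface map `y ↦ ι(c⁻¹ y)` is `C^∞` on `c.target`. [folklore] -/
theorem contMDiffOn_embed_symm :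
    ContMDiffOn 𝓘(ℝ, E3) (𝓡 4) ∞ (fun y ↦ 𝒮.embed ((chartAt E3 x₀).symm y)) (chartAt E3 x₀).target :=
  𝒮.isSmoothEmbedding.contMDiff.comp_contMDiffOn contMDiffOn_chart_symm

/-- `P` is `C^∞` on `B₀`. [folklore] -/
theorem contDiffOn_gcP : ContDiffOn ℝ ∞ (gcP 𝒮 x₀ cs) (gcB₀ 𝒮 x₀) := by
  have h1 : ContMDiffOn 𝓘(ℝ, E3) 𝓘(ℝ, E4) ∞
      (fun y ↦ chartAt E4 (𝒮.embed x₀) (𝒮.embed ((chartAt E3 x₀).symm y))) (gcB₀ 𝒮 x₀) :=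
    (contMDiffOn_chart (I := 𝓡 4) (x := 𝒮.embed x₀) (n := ∞)).comp
      (contMDiffOn_embed_symm.mono inter_subset_left) fun _ hy ↦ hy.2
  exact cs.contDiff.comp_contDiffOn (contMDiffOn_iff_contDiffOn.1 h1)

/-- `N` is `C^∞` on `B₀` (the normal is smooth along `ι`, `contMDiffAt_embed_normal`, read through
the tangent trivialisation at `ι x₀`). [folklore] -/
theorem contDiffOn_gcN : ContDiffOn ℝ ∞ (gcN 𝒮 x₀ cs) (gcB₀ 𝒮 x₀) := by
  set e := trivializationAt E4 (TangentSpace (𝓡 4) : 𝒮.carrier → Type _) (𝒮.embed x₀) with he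
  set sec : E3 → TangentBundle (𝓡 4) 𝒮.carrier := fun y ↦
    TotalSpace.mk' E4 (𝒮.embed ((chartAt E3 x₀).symm y)) (𝒮.normal ((chartAt E3 x₀).symm y)) with hsec
  have hsecM : ContMDiffOn 𝓘(ℝ, E3) (𝓡 4).tangent ∞ sec (gcB₀ 𝒮 x₀) := by
    have h : ContMDiff (𝓡 3) (𝓡 4).tangent ∞ (fun x ↦
        (TotalSpace.mk' E4 (𝒮.embed x) (𝒮.normal x) : TangentBundle (𝓡 4) 𝒮.carrier)) :=
      fun x ↦ 𝒮.contMDiffAt_embed_normal x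
    exact h.comp_contMDiffOn (contMDiffOn_chart_symm.mono inter_subset_left)
  have hmaps : MapsTo sec (gcB₀ 𝒮 x₀) e.source := fun y hy ↦ by
    rw [e.mem_source, he, TangentBundle.trivializationAt_baseSet]
    exact hy.2
  have h2 := ((e.contMDiffOn_iff (IB := 𝓡 4) (n := ∞) hmaps).1 hsecM).2
  exact cs.contDiff.comp_contDiffOn (contMDiffOn_iff_contDiffOn.1 h2)

/-- **The value of the normal reading**: `cs⁻¹(N y) = dψ(ν(c⁻¹ y))`. [folklore] -/
theorem symm_gcN {y : E3} (hy : y ∈ gcB₀ 𝒮 x₀) :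
    cs.symm (gcN 𝒮 x₀ cs y) = mfderiv (𝓡 4) 𝓘(ℝ, E4) (chartAt E4 (𝒮.embed x₀))
      (𝒮.embed ((chartAt E3 x₀).symm y)) (𝒮.normal ((chartAt E3 x₀).symm y)) := by
  have hb : 𝒮.embed ((chartAt E3 x₀).symm y) ∈
      (trivializationAt E4 (TangentSpace (𝓡 4) : 𝒮.carrier → Type _) (𝒮.embed x₀)).baseSet := by
    rw [TangentBundle.trivializationAt_baseSet]; exact hy.2
  rw [gcN, ContinuousLinearEquiv.symm_apply_apply,
    ← Trivialization.continuousLinearMapAt_apply_of_mem (R := ℝ) _ hb,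
    TangentBundle.continuousLinearMapAt_trivializationAt hy.2]
  rfl

/-- `Φ₀ext (P y) = ι(c⁻¹ y)` on `B₀`. [folklore] -/
theorem gcΦ₀ext_gcP {y : E3} (hy : y ∈ gcB₀ 𝒮 x₀) :
    gcΦ₀ext 𝒮 x₀ cs (gcP 𝒮 x₀ cs y) = 𝒮.embed ((chartAt E3 x₀).symm y) := by
  simp only [gcΦ₀ext, gcP, ContinuousLinearEquiv.symm_apply_apply]
  exact (chartAt E4 (𝒮.embed x₀)).left_inv hy.2

/-- `P` maps `B₀` into `U₀`. [folklore] -/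
theorem gcP_mem {y : E3} (hy : y ∈ gcB₀ 𝒮 x₀) : gcP 𝒮 x₀ cs y ∈ gcU₀ 𝒮 x₀ cs := by
  rw [mem_gcU₀, gcP, ContinuousLinearEquiv.symm_apply_apply]
  exact (chartAt E4 (𝒮.embed x₀)).map_source hy.2

/-- **`dΦ₀ext_{P y}(N y) = ν(c⁻¹ y)`.** [folklore] -/
theorem mfderiv_gcΦ₀ext_gcN {y : E3} (hy : y ∈ gcB₀ 𝒮 x₀) :
    mfderiv 𝓘(ℝ, ℝ × E3) (𝓡 4) (gcΦ₀ext 𝒮 x₀ cs) (gcP 𝒮 x₀ cs y) (gcN 𝒮 x₀ cs y) =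
      𝒮.normal ((chartAt E3 x₀).symm y) := by
  rw [mfderiv_gcΦ₀ext 𝒮 x₀ cs (gcP_mem hy), symm_gcN hy]
  have hcs : cs.symm (gcP 𝒮 x₀ cs y) = chartAt E4 (𝒮.embed x₀) (𝒮.embed ((chartAt E3 x₀).symm y)) :=
    cs.symm_apply_apply _
  rw [hcs]
  exact mfderiv_chart_symm_mfderiv_chart 𝒮 x₀ hy.2 _

/-- **`d(Φ₀ext ∘ P)_y = d(ι ∘ c⁻¹)_y`**: `dΦ₀ext_{P y}(DP_y v) = dι(d(c⁻¹)_y v)`. [folklore] -/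
theorem mfderiv_gcΦ₀ext_fderiv_gcP {y : E3} (hy : y ∈ gcB₀ 𝒮 x₀) (v : E3) :
    mfderiv 𝓘(ℝ, ℝ × E3) (𝓡 4) (gcΦ₀ext 𝒮 x₀ cs) (gcP 𝒮 x₀ cs y) (fderiv ℝ (gcP 𝒮 x₀ cs) y v) =
      mfderiv (𝓡 3) (𝓡 4) 𝒮.embed ((chartAt E3 x₀).symm y)
        (mfderiv 𝓘(ℝ, E3) (𝓡 3) (chartAt E3 x₀).symm y v) := by
  have hBn : gcB₀ 𝒮 x₀ ∈ 𝓝 y := isOpen_gcB₀ 𝒮 x₀ |>.mem_nhds hy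
  -- `Φ₀ext ∘ P = ι ∘ c⁻¹` near `y`
  have hev : (gcΦ₀ext 𝒮 x₀ cs ∘ gcP 𝒮 x₀ cs) =ᶠ[𝓝 y] fun y' ↦ 𝒮.embed ((chartAt E3 x₀).symm y') := by
    filter_upwards [hBn] with y' hy'
    exact gcΦ₀ext_gcP hy'
  have hP : MDifferentiableAt 𝓘(ℝ, E3) 𝓘(ℝ, ℝ × E3) (gcP 𝒮 x₀ cs) y :=
    ((contDiffOn_gcP y hy).contDiffAt hBn).contMDiffAt.mdifferentiableAt (by simp)
  have hΦ : MDifferentiableAt 𝓘(ℝ, ℝ × E3) (𝓡 4) (gcΦ₀ext 𝒮 x₀ cs) (gcP 𝒮 x₀ cs y) :=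
    ((contMDiffOn_gcΦ₀ext 𝒮 x₀ cs).contMDiffAt ((gcU₀ 𝒮 x₀ cs).2.mem_nhds (gcP_mem hy))).mdifferentiableAt
      (by simp)
  have hcomp := mfderiv_comp y hΦ hP
  have hc : MDifferentiableAt 𝓘(ℝ, E3) (𝓡 3) (chartAt E3 x₀).symm y :=
    (mdifferentiable_chart (I := 𝓡 3) x₀).mdifferentiableAt_symm hy.1
  have hι : MDifferentiableAt (𝓡 3) (𝓡 4) 𝒮.embed ((chartAt E3 x₀).symm y) := 𝒮.mdifferentiable_embed _
  have hcomp2 := mfderiv_comp y hι hc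
  have h := hev.mfderiv_eq (I := 𝓘(ℝ, E3)) (I' := 𝓡 4)
  rw [hcomp, show (fun y' ↦ 𝒮.embed ((chartAt E3 x₀).symm y')) = 𝒮.embed ∘ (chartAt E3 x₀).symm from rfl,
    hcomp2] at h
  have h' : mfderiv 𝓘(ℝ, ℝ × E3) (𝓡 4) (gcΦ₀ext 𝒮 x₀ cs) (gcP 𝒮 x₀ cs y)
      (mfderiv 𝓘(ℝ, E3) 𝓘(ℝ, ℝ × E3) (gcP 𝒮 x₀ cs) y v) =
      mfderiv (𝓡 3) (𝓡 4) 𝒮.embed ((chartAt E3 x₀).symm y)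
        (mfderiv 𝓘(ℝ, E3) (𝓡 3) (chartAt E3 x₀).symm y v) := by
    have := congrArg (fun L : E3 →L[ℝ] TangentSpace (𝓡 4) (𝒮.embed ((chartAt E3 x₀).symm y)) ↦ L v) h
    exact this
  have hPf : mfderiv 𝓘(ℝ, E3) 𝓘(ℝ, ℝ × E3) (gcP 𝒮 x₀ cs) y v = fderiv ℝ (gcP 𝒮 x₀ cs) y v := by
    rw [mfderiv_eq_fderiv]; rfl
  rw [← hPf]
  exact h'

omit [ConnectedSpace X] in
/-- `d(c⁻¹)_y` is injective at the points of `c.target`. [folklore] -/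
theorem injective_mfderiv_chart_symm {y : E3} (hy : y ∈ (chartAt E3 x₀).target) :
    Injective (mfderiv 𝓘(ℝ, E3) (𝓡 3) (chartAt E3 x₀).symm y) :=
  ((mdifferentiable_chart (I := 𝓡 3) x₀).symm.mfderiv hy).injective

/-- **The readings form a slice reading** of the hypersurface `ι(X)` with its unit normal:
`G₀(N, N) = g(ν, ν) = −1`, `G₀(N, DP v) = g(ν, dι d(c⁻¹) v) = 0`, `DP` injective.
[cite: Wald1984, §10.2] -/
theorem isSliceReading :
    IsSliceReading (gcG₀ 𝒮 x₀ cs) (gcP 𝒮 x₀ cs) (gcN 𝒮 x₀ cs) (gcU₀ 𝒮 x₀ cs) (gcB₀ 𝒮 x₀) where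
  isOpen := isOpen_gcB₀ 𝒮 x₀
  contDiffOn_P := contDiffOn_gcP
  contDiffOn_N := contDiffOn_gcN
  mapsTo := fun _ hy ↦ gcP_mem hy
  injective := fun y hy v₁ v₂ h ↦ by
    have h' := congrArg (mfderiv 𝓘(ℝ, ℝ × E3) (𝓡 4) (gcΦ₀ext 𝒮 x₀ cs) (gcP 𝒮 x₀ cs y)) h
    rw [mfderiv_gcΦ₀ext_fderiv_gcP hy, mfderiv_gcΦ₀ext_fderiv_gcP hy] at h'
    exact injective_mfderiv_chart_symm hy.1 (𝒮.mfderiv_embed_injective _ h')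
  unit := fun y hy ↦ by
    rw [gcG₀_apply 𝒮 x₀ cs (gcP_mem hy), mfderiv_gcΦ₀ext_gcN hy, gcΦ₀ext_gcP hy]
    exact 𝒮.isFutureUnitNormal.1.2 _
  normal := fun y hy v ↦ by
    rw [gcG₀_apply 𝒮 x₀ cs (gcP_mem hy), mfderiv_gcΦ₀ext_gcN hy, mfderiv_gcΦ₀ext_fderiv_gcP hy,
      gcΦ₀ext_gcP hy]
    exact 𝒮.isFutureUnitNormal.1.1 _ _

/-! ### The second-order Gaussian chart -/

variable (𝒮 x₀ cs)

/-- **The Gaussian slice map** of the data hypersurface read in the chart. [cite: Wald1984, §3.3] -/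
def gcF : ℝ × E3 → ℝ × E3 := gaussMap (gcG₀ 𝒮 x₀ cs) (gcP 𝒮 x₀ cs) (gcN 𝒮 x₀ cs)

/-- **The Gaussian domain** (`gaussDom`). [cite: Wald1984, §3.3] -/
def gcDom : Set (ℝ × E3) := gaussDom (gcG₀ 𝒮 x₀ cs) (gcP 𝒮 x₀ cs) (gcN 𝒮 x₀ cs) (gcU₀ 𝒮 x₀ cs) (gcB₀ 𝒮 x₀)

/-- The Gaussian slice map is a change of coordinates from the Gaussian domain to `U₀`.
[cite: Wald1984, §3.3] -/
theorem isCoordChangeOn_gcF : IsCoordChangeOn (gcF 𝒮 x₀ cs) (gcDom 𝒮 x₀ cs) (gcU₀ 𝒮 x₀ cs) :=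
  isCoordChangeOn_gaussMap (isMetricOn_gcG₀ 𝒮 x₀ cs) isSliceReading

/-- The slice points lie in the Gaussian domain. [folklore] -/
theorem svec_mem_gcDom {y : E3} (hy : y ∈ gcB₀ 𝒮 x₀) : svec y ∈ gcDom 𝒮 x₀ cs :=
  svec_mem_gaussDom (isMetricOn_gcG₀ 𝒮 x₀ cs) isSliceReading hy

/-- The Gaussian domain as an open subset. [folklore] -/
def gcV : Opens (ℝ × E3) := ⟨gcDom 𝒮 x₀ cs, (isCoordChangeOn_gcF 𝒮 x₀ cs).isOpen⟩

/-- **The Gaussian chart** `Φ = Φ₀ ∘ F̂`, as a map of all of `ℝ × E3`. [cite: Wald1984, §3.3] -/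
def gcΦext : ℝ × E3 → 𝒮.carrier := fun q ↦ gcΦ₀ext 𝒮 x₀ cs (gcF 𝒮 x₀ cs q)

/-- The Gaussian chart on the Gaussian domain. [cite: Wald1984, §3.3] -/
def gcΦ : gcV 𝒮 x₀ cs → 𝒮.carrier := fun q ↦ gcΦext 𝒮 x₀ cs q

/-- The extended Gaussian chart is `C^∞` on the Gaussian domain. [folklore] -/
theorem contMDiffOn_gcΦext : ContMDiffOn 𝓘(ℝ, ℝ × E3) (𝓡 4) ∞ (gcΦext 𝒮 x₀ cs) (gcV 𝒮 x₀ cs) :=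
  (contMDiffOn_gcΦ₀ext 𝒮 x₀ cs).comp (isCoordChangeOn_gcF 𝒮 x₀ cs).contDiffOn.contMDiffOn
    (isCoordChangeOn_gcF 𝒮 x₀ cs).mapsTo

/-- The Gaussian chart is `C^∞` (`∞ + 1 = ∞`). [folklore] -/
theorem contMDiff_gcΦ : ContMDiff 𝓘(ℝ, ℝ × E3) (𝓡 4) (∞ + 1) (gcΦ 𝒮 x₀ cs) := by
  have h : ((∞ : ℕ∞ω) + 1) = ∞ := rfl
  rw [h]
  exact (contMDiffOn_gcΦext 𝒮 x₀ cs).comp_contMDiff contMDiff_subtype_val fun u ↦ u.2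

/-- **Chain rule for the Gaussian chart**: `dΦext_q = dΦ₀ext_{F̂ q} ∘ DF̂_q` on the Gaussian domain.
[folklore] -/
theorem mfderiv_gcΦext {q : ℝ × E3} (hq : q ∈ gcDom 𝒮 x₀ cs) (a : ℝ × E3) :
    mfderiv 𝓘(ℝ, ℝ × E3) (𝓡 4) (gcΦext 𝒮 x₀ cs) q a =
      mfderiv 𝓘(ℝ, ℝ × E3) (𝓡 4) (gcΦ₀ext 𝒮 x₀ cs) (gcF 𝒮 x₀ cs q) (fderiv ℝ (gcF 𝒮 x₀ cs) q a) := by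
  have hF := isCoordChangeOn_gcF 𝒮 x₀ cs
  have h1 : MDifferentiableAt 𝓘(ℝ, ℝ × E3) 𝓘(ℝ, ℝ × E3) (gcF 𝒮 x₀ cs) q :=
    (hF.contDiffAt hq).contMDiffAt.mdifferentiableAt (by simp)
  have h2 : MDifferentiableAt 𝓘(ℝ, ℝ × E3) (𝓡 4) (gcΦ₀ext 𝒮 x₀ cs) (gcF 𝒮 x₀ cs q) :=
    ((contMDiffOn_gcΦ₀ext 𝒮 x₀ cs).contMDiffAt ((gcU₀ 𝒮 x₀ cs).2.mem_nhds (hF.mapsTo hq))).mdifferentiableAt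
      (by simp)
  have h := mfderiv_comp q h2 h1
  rw [show gcΦext 𝒮 x₀ cs = gcΦ₀ext 𝒮 x₀ cs ∘ gcF 𝒮 x₀ cs from rfl, h]
  change mfderiv 𝓘(ℝ, ℝ × E3) (𝓡 4) (gcΦ₀ext 𝒮 x₀ cs) (gcF 𝒮 x₀ cs q)
      (mfderiv 𝓘(ℝ, ℝ × E3) 𝓘(ℝ, ℝ × E3) (gcF 𝒮 x₀ cs) q a) = _
  congr 1
  exact congrArg (fun L : (ℝ × E3) →L[ℝ] (ℝ × E3) ↦ L a) (mfderiv_eq_fderiv (f := gcF 𝒮 x₀ cs) (x := q))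

/-- The differential of the Gaussian chart is that of the extended one. [folklore] -/
theorem mfderiv_gcΦ (q : gcV 𝒮 x₀ cs) :
    mfderiv 𝓘(ℝ, ℝ × E3) (𝓡 4) (gcΦ 𝒮 x₀ cs) q = mfderiv 𝓘(ℝ, ℝ × E3) (𝓡 4) (gcΦext 𝒮 x₀ cs) q :=
  (ImmersionChart.mfderiv_ext_eq (Φ := gcΦ 𝒮 x₀ cs) (fun _ ↦ rfl) (contMDiffOn_gcΦext 𝒮 x₀ cs) q).symm

/-- The differentials of the extended inverse chart are injective on `U₀`. [folklore] -/
theorem injective_mfderiv_gcΦ₀ext {u : ℝ × E3} (hu : u ∈ gcU₀ 𝒮 x₀ cs) :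
    Injective (mfderiv 𝓘(ℝ, ℝ × E3) (𝓡 4) (gcΦ₀ext 𝒮 x₀ cs) u) := by
  have h := injective_mfderiv_gcΦ₀ 𝒮 x₀ cs ⟨u, hu⟩
  rwa [mfderiv_gcΦ₀] at h

/-- The differentials of the Gaussian chart are injective. [folklore] -/
theorem injective_mfderiv_gcΦ :
    ∀ q : gcV 𝒮 x₀ cs, Injective (mfderiv 𝓘(ℝ, ℝ × E3) (𝓡 4) (gcΦ 𝒮 x₀ cs) q) := fun q ↦ by
  rw [mfderiv_gcΦ]
  intro a b h
  have ha := mfderiv_gcΦext 𝒮 x₀ cs q.2 a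
  have hb := mfderiv_gcΦext 𝒮 x₀ cs q.2 b
  have hF := isCoordChangeOn_gcF 𝒮 x₀ cs
  have h' : mfderiv 𝓘(ℝ, ℝ × E3) (𝓡 4) (gcΦ₀ext 𝒮 x₀ cs) (gcF 𝒮 x₀ cs q) (fderiv ℝ (gcF 𝒮 x₀ cs) q a) =
      mfderiv 𝓘(ℝ, ℝ × E3) (𝓡 4) (gcΦ₀ext 𝒮 x₀ cs) (gcF 𝒮 x₀ cs q) (fderiv ℝ (gcF 𝒮 x₀ cs) q b) := by
    rw [← ha, ← hb]; exact h
  exact hF.injective q.2 (injective_mfderiv_gcΦ₀ext 𝒮 x₀ cs (hF.mapsTo q.2) h')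

/-- **The metric components in the Gaussian chart**: `G = (Φ^* g)` read on `ℝ × E3`.
[cite: Wald1984, §3.3] -/
def gcG : (ℝ × E3) → (ℝ × E3) →L[ℝ] (ℝ × E3) →L[ℝ] ℝ :=
  ImmersionChart.repr 𝒮.metric.toPseudoRiemannianMetric (contMDiff_gcΦ 𝒮 x₀ cs)
    (injective_mfderiv_gcΦ 𝒮 x₀ cs) finrank_prod_eq

/-- The Gaussian components are smooth, symmetric and nondegenerate on the Gaussian domain.
[folklore] -/
theorem isMetricOn_gcG : IsMetricOn (gcG 𝒮 x₀ cs) (gcDom 𝒮 x₀ cs) :=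
  ImmersionChart.isMetricOn_repr _ _ _ _

/-- **`G = F̂^* G₀` on the Gaussian domain** (functoriality of the pull-back). [folklore] -/
theorem gcG_eq_pullMetric {q : ℝ × E3} (hq : q ∈ gcDom 𝒮 x₀ cs) :
    gcG 𝒮 x₀ cs q = pullMetric (gcG₀ 𝒮 x₀ cs) (gcF 𝒮 x₀ cs) q := by
  have hF := isCoordChangeOn_gcF 𝒮 x₀ cs
  refine ContinuousLinearMap.ext fun a ↦ ContinuousLinearMap.ext fun b ↦ ?_
  rw [gcG, ImmersionChart.repr_apply_of_mem _ _ _ _ hq, pullMetric_apply,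
    gcG₀_apply 𝒮 x₀ cs (hF.mapsTo hq), ← mfderiv_gcΦext 𝒮 x₀ cs hq, ← mfderiv_gcΦext 𝒮 x₀ cs hq,
    ← mfderiv_gcΦ 𝒮 x₀ cs ⟨q, hq⟩]
  rfl

/-- `G = F̂^* G₀` near every point of the Gaussian domain. [folklore] -/
theorem gcG_eventuallyEq {q : ℝ × E3} (hq : q ∈ gcDom 𝒮 x₀ cs) :
    gcG 𝒮 x₀ cs =ᶠ[𝓝 q] pullMetric (gcG₀ 𝒮 x₀ cs) (gcF 𝒮 x₀ cs) := by
  filter_upwards [(isCoordChangeOn_gcF 𝒮 x₀ cs).isOpen.mem_nhds hq] with q' hq'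
  exact gcG_eq_pullMetric 𝒮 x₀ cs hq'

/-- **The Gaussian components form a Gaussian slice** on `B₀`: `G₀₀ = −1`, `G₀ᵢ = 0`,
`∂_t G₀_μ = 0` along `{0} × B₀`. [cite: Wald1984, §3.3] -/
theorem isGaussianSlice_gcG : IsGaussianSlice (gcG 𝒮 x₀ cs) (gcB₀ 𝒮 x₀) := by
  have hS := isGaussianSlice_pullMetric (isMetricOn_gcG₀ 𝒮 x₀ cs) (isSliceReading (cs := cs))
  refine ⟨fun y hy ↦ ?_, fun y hy v ↦ ?_, fun y hy w ↦ ?_⟩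
  · rw [gcG_eq_pullMetric 𝒮 x₀ cs (svec_mem_gcDom 𝒮 x₀ cs hy)]; exact hS.g00 y hy
  · rw [gcG_eq_pullMetric 𝒮 x₀ cs (svec_mem_gcDom 𝒮 x₀ cs hy)]; exact hS.g0x y hy v
  · rw [(gcG_eventuallyEq 𝒮 x₀ cs (svec_mem_gcDom 𝒮 x₀ cs hy)).fderiv_eq]; exact hS.dg0 y hy w

/-- **The induced metric of the Gaussian slice is the data metric read through `c⁻¹`**:
`G(ṽ, w̃) = h(d(c⁻¹) v, d(c⁻¹) w)`. [cite: Wald1984, (10.2.9)] -/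
theorem sliceMetric_gcG {y : E3} (hy : y ∈ gcB₀ 𝒮 x₀) (v w : E3) :
    sliceMetric (gcG 𝒮 x₀ cs) y v w =
      D.h.inner ((chartAt E3 x₀).symm y) (mfderiv 𝓘(ℝ, E3) (𝓡 3) (chartAt E3 x₀).symm y v)
        (mfderiv 𝓘(ℝ, E3) (𝓡 3) (chartAt E3 x₀).symm y w) := by
  rw [sliceMetric_apply, gcG_eq_pullMetric 𝒮 x₀ cs (svec_mem_gcDom 𝒮 x₀ cs hy), ← sliceMetric_apply]
  unfold gcF
  rw [sliceMetric_pullMetric (isMetricOn_gcG₀ 𝒮 x₀ cs) isSliceReading hy,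
    gcG₀_apply 𝒮 x₀ cs (gcP_mem hy), mfderiv_gcΦ₀ext_fderiv_gcP hy, mfderiv_gcΦ₀ext_fderiv_gcP hy,
    gcΦ₀ext_gcP hy, ← 𝒮.induced_h]
  rfl

/-- The induced metric of the Gaussian slice is positive definite. [folklore] -/
theorem sliceMetric_gcG_pos {y : E3} (hy : y ∈ gcB₀ 𝒮 x₀) {v : E3} (hv : v ≠ 0) :
    0 < sliceMetric (gcG 𝒮 x₀ cs) y v v := by
  rw [sliceMetric_gcG 𝒮 x₀ cs hy]
  refine D.h.pos _ _ fun h ↦ hv ?_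
  refine injective_mfderiv_chart_symm hy.1 ?_
  exact h.trans (map_zero _).symm

/-- **The Gaussian components are slice-hyperbolic at the slice points.** [cite: HawkingEllis1973CUP, §7.4] -/
theorem isSliceHyperbolic_gcG {ι : Type*} [Fintype ι] (b₀ : Module.Basis ι ℝ E3) {y : E3}
    (hy : y ∈ gcB₀ 𝒮 x₀) : IsSliceHyperbolic (sliceBasis b₀) (gcG 𝒮 x₀ cs (svec y)) :=
  isSliceHyperbolic_of_isGaussianSlice b₀ (isMetricOn_gcG 𝒮 x₀ cs) (isGaussianSlice_gcG 𝒮 x₀ cs)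
    (isOpen_gcB₀ 𝒮 x₀) (fun _ hy' ↦ svec_mem_gcDom 𝒮 x₀ cs hy') hy
    fun _ hv ↦ sliceMetric_gcG_pos 𝒮 x₀ cs hy hv

/-- **The vacuum equations in the Gaussian chart**: `Ric(G) = 0` on the Gaussian domain when `𝒮`
is vacuum. [cite: ONeill1983, Ch. 3, Prop. 3.59] -/
theorem ricAt_gcG_eq_zero [𝒮.metric.toPseudoRiemannianMetric.HasLeviCivita] (hvac : 𝒮.IsVacuum)
    {q : ℝ × E3} (hq : q ∈ gcDom 𝒮 x₀ cs) (Y₀ Z₀ : ℝ × E3) :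
    ricAt (gcG 𝒮 x₀ cs) q Y₀ Z₀ = 0 := by
  haveI : Fact (1 ≤ 4) := ⟨by norm_num⟩
  exact ImmersionChart.ricAt_repr_eq_zero _ _ _ _ hvac hq Y₀ Z₀

/-- **`Φ(0, y) = ι(c⁻¹ y)`.** [cite: Wald1984, §3.3] -/
theorem gcΦext_svec {y : E3} (hy : y ∈ gcB₀ 𝒮 x₀) :
    gcΦext 𝒮 x₀ cs (svec y) = 𝒮.embed ((chartAt E3 x₀).symm y) := by
  rw [gcΦext, gcF, gaussMap_svec, gcΦ₀ext_gcP hy]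

/-- **`dΦ_{(0,y)} e₀ = ν(c⁻¹ y)`.** [cite: Wald1984, §3.3] -/
theorem mfderiv_gcΦext_svec_tvec {y : E3} (hy : y ∈ gcB₀ 𝒮 x₀) :
    mfderiv 𝓘(ℝ, ℝ × E3) (𝓡 4) (gcΦext 𝒮 x₀ cs) (svec y) tvec = 𝒮.normal ((chartAt E3 x₀).symm y) := by
  rw [mfderiv_gcΦext 𝒮 x₀ cs (svec_mem_gcDom 𝒮 x₀ cs hy), gcF,
    fderiv_gaussMap_svec_tvec (isMetricOn_gcG₀ 𝒮 x₀ cs) isSliceReading hy, gaussMap_svec,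
    mfderiv_gcΦ₀ext_gcN hy]

/-- **`dΦ_{(0,y)} ṽ = dι (d(c⁻¹) v)`.** [cite: Wald1984, §3.3] -/
theorem mfderiv_gcΦext_svec_svec {y : E3} (hy : y ∈ gcB₀ 𝒮 x₀) (v : E3) :
    mfderiv 𝓘(ℝ, ℝ × E3) (𝓡 4) (gcΦext 𝒮 x₀ cs) (svec y) (svec v) =
      mfderiv (𝓡 3) (𝓡 4) 𝒮.embed ((chartAt E3 x₀).symm y)
        (mfderiv 𝓘(ℝ, E3) (𝓡 3) (chartAt E3 x₀).symm y v) := by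
  rw [mfderiv_gcΦext 𝒮 x₀ cs (svec_mem_gcDom 𝒮 x₀ cs hy), gcF,
    fderiv_gaussMap_svec_svec (isMetricOn_gcG₀ 𝒮 x₀ cs) isSliceReading hy, gaussMap_svec,
    mfderiv_gcΦ₀ext_fderiv_gcP hy]

/-! ### The second fundamental form in the Gaussian chart -/

/-- Congruence of the second fundamental form in the pair (map, normal field). [folklore] -/
theorem secondFundamentalForm_congr_map
    {g : PseudoRiemannianMetric (𝓡 4) ∞ E4 (TangentSpace (𝓡 4) : 𝒮.carrier → Type _)}
    [g.HasLeviCivita] {P : Type*} [TopologicalSpace P] [ChartedSpace E3 P]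
    {F₁ F₂ : P → 𝒮.carrier} (hF : F₁ = F₂) {ν₁ : NormalField (𝓡 4) F₁} {ν₂ : NormalField (𝓡 4) F₂}
    (hν : ∀ u, ν₁ u = ν₂ u) (u : P) :
    g.secondFundamentalForm 𝓘(ℝ, E3) F₁ ν₁ u = g.secondFundamentalForm 𝓘(ℝ, E3) F₂ ν₂ u := by
  subst hF
  have h : ν₁ = ν₂ := funext hν
  subst h
  rfl

/-- **The second fundamental form of the Gaussian slice is the data tensor read through `c⁻¹`**:
`½ ∂_t G(ṽ, w̃) = k(d(c⁻¹) v, d(c⁻¹) w)`. The coordinate formula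
`½ ∂_t G(ṽ, w̃) = G₀(DN v + Γ(DP v, N), DP w)` (`sliceK_pullMetric`) is the second fundamental form of
the reading `P` with normal `N` for `Φ₀^* g` (`OpensChart.secondFundamentalForm_eq_of_repr`), which
by naturality under `Φ₀` (`secondFundamentalForm_comap`) and under `c⁻¹`
(`secondFundamentalForm_comp_right`) is `K_{ι,ν} = k` (`induced_k`) on `d(c⁻¹) v`, `d(c⁻¹) w`.
[cite: Wald1984, (10.2.13)] -/
theorem sliceK_gcG [𝒮.metric.toPseudoRiemannianMetric.HasLeviCivita] {y : E3} (hy : y ∈ gcB₀ 𝒮 x₀)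
    (v w : E3) :
    sliceK (gcG 𝒮 x₀ cs) y v w =
      D.k ((chartAt E3 x₀).symm y) (mfderiv 𝓘(ℝ, E3) (𝓡 3) (chartAt E3 x₀).symm y v)
        (mfderiv 𝓘(ℝ, E3) (𝓡 3) (chartAt E3 x₀).symm y w) := by
  set g := 𝒮.metric.toPseudoRiemannianMetric with hg_def
  -- Step 1: the coordinate formula
  have h1 : sliceK (gcG 𝒮 x₀ cs) y v w = gcG₀ 𝒮 x₀ cs (gcP 𝒮 x₀ cs y)
      (fderiv ℝ (gcN 𝒮 x₀ cs) y v + chrAt (gcG₀ 𝒮 x₀ cs) (gcP 𝒮 x₀ cs y) (fderiv ℝ (gcP 𝒮 x₀ cs) y v)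
        (gcN 𝒮 x₀ cs y)) (fderiv ℝ (gcP 𝒮 x₀ cs) y w) := by
    rw [sliceK_apply, (gcG_eventuallyEq 𝒮 x₀ cs (svec_mem_gcDom 𝒮 x₀ cs hy)).fderiv_eq, ← sliceK_apply]
    unfold gcF
    exact sliceK_pullMetric (isMetricOn_gcG₀ 𝒮 x₀ cs) isSliceReading hy v w
  -- Step 2: the chart-domain picture `f : B' → U₀`, `f = P`, normal `N`
  set B' : Opens E3 := ⟨gcB₀ 𝒮 x₀, isOpen_gcB₀ 𝒮 x₀⟩ with hB'_def
  set u : B' := ⟨y, hy⟩ with hu_def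
  set f : B' → gcU₀ 𝒮 x₀ cs := fun u' ↦ ⟨gcP 𝒮 x₀ cs u', gcP_mem u'.2⟩ with hf_def
  set Nf : NormalField 𝓘(ℝ, ℝ × E3) f := fun u' ↦
    (gcN 𝒮 x₀ cs u' : TangentSpace 𝓘(ℝ, ℝ × E3) (f u')) with hNf_def
  have hΦ₀ := contMDiff_gcΦ₀ 𝒮 x₀ cs
  have hΦ₀' := injective_mfderiv_gcΦ₀ 𝒮 x₀ cs
  set g₀ := ImmersionChart.metric g hΦ₀ hΦ₀' finrank_prod_eq with hg₀_def
  haveI hLC₀ : g₀.HasLeviCivita := g₀.hasLeviCivita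
  haveI : (g.comap PseudoRiemannianMetric.contMDiff_pullbackBilin_holds (gcΦ₀ 𝒮 x₀ cs) hΦ₀ hΦ₀'
      finrank_prod_eq).HasLeviCivita := hLC₀
  have hrepr : ∀ x : gcU₀ 𝒮 x₀ cs, g₀.val x = gcG₀ 𝒮 x₀ cs x :=
    ImmersionChart.metric_val_eq_repr g hΦ₀ hΦ₀' finrank_prod_eq
  have hBn : gcB₀ 𝒮 x₀ ∈ 𝓝 y := (isOpen_gcB₀ 𝒮 x₀).mem_nhds hy
  have hPd : DifferentiableAt ℝ (gcP 𝒮 x₀ cs) y :=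
    ((contDiffOn_gcP y hy).contDiffAt hBn).differentiableAt (by simp)
  have hNd : DifferentiableAt ℝ (gcN 𝒮 x₀ cs) y :=
    ((contDiffOn_gcN y hy).contDiffAt hBn).differentiableAt (by simp)
  have hGd : DifferentiableAt ℝ (gcG₀ 𝒮 x₀ cs) (f u) :=
    (isMetricOn_gcG₀ 𝒮 x₀ cs).differentiableAt (gcP_mem hy)
  have h2 : g₀.secondFundamentalForm 𝓘(ℝ, E3) f Nf u v w = gcG₀ 𝒮 x₀ cs (gcP 𝒮 x₀ cs y)
      (fderiv ℝ (gcN 𝒮 x₀ cs) y v + chrAt (gcG₀ 𝒮 x₀ cs) (gcP 𝒮 x₀ cs y) (fderiv ℝ (gcP 𝒮 x₀ cs) y v)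
        (gcN 𝒮 x₀ cs y)) (fderiv ℝ (gcP 𝒮 x₀ cs) y w) := by
    rw [OpensChart.secondFundamentalForm_eq_of_repr hrepr (f := f) (Φ := gcP 𝒮 x₀ cs) (fun _ ↦ rfl)
      (ν := Nf) (N := gcN 𝒮 x₀ cs) (fun _ ↦ rfl) hPd hNd hGd v w, hrepr,
      OpensChart.christoffel_eq_chrAt hrepr (f u)]
    rfl
  -- Step 3: naturality under `Φ₀`
  have hν : MDifferentiableAt 𝓘(ℝ, E3) (𝓘(ℝ, ℝ × E3).prod 𝓘(ℝ, ℝ × E3))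
      (fun x ↦ (TotalSpace.mk' (ℝ × E3) (f x) (Nf x) : TangentBundle 𝓘(ℝ, ℝ × E3) (gcU₀ 𝒮 x₀ cs))) u :=
    OpensChart.mdifferentiableAt_lift_of_repr (f := f) (Φ := gcP 𝒮 x₀ cs) (fun _ ↦ rfl) (ν := Nf)
      (N := gcN 𝒮 x₀ cs) (fun _ ↦ rfl) hPd hNd
  have h3 := PseudoRiemannianMetric.secondFundamentalForm_comap g
    PseudoRiemannianMetric.contMDiff_pullbackBilin_holds hΦ₀ hΦ₀' finrank_prod_eq
    (I'' := 𝓘(ℝ, E3)) (f := f) (ν := Nf) (y := u) BoundarylessManifold.isInteriorPoint hν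
  -- Step 4: `Φ₀ ∘ f = ι ∘ c⁻¹` and the transported normal is `ν ∘ c⁻¹`
  set Ψ : B' → X := fun u' ↦ (chartAt E3 x₀).symm u' with hΨ_def
  have hfΨ : gcΦ₀ 𝒮 x₀ cs ∘ f = 𝒮.embed ∘ Ψ := funext fun u' ↦ gcΦ₀ext_gcP u'.2
  have hνΨ : ∀ u' : B', mfderiv 𝓘(ℝ, ℝ × E3) (𝓡 4) (gcΦ₀ 𝒮 x₀ cs) (f u') (Nf u') = 𝒮.normal (Ψ u') :=
    fun u' ↦ by
    rw [mfderiv_gcΦ₀]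
    exact mfderiv_gcΦ₀ext_gcN u'.2
  have h4 := secondFundamentalForm_congr_map 𝒮 (g := g) hfΨ
    (ν₁ := fun u' ↦ mfderiv 𝓘(ℝ, ℝ × E3) (𝓡 4) (gcΦ₀ 𝒮 x₀ cs) (f u') (Nf u'))
    (ν₂ := fun u' ↦ 𝒮.normal (Ψ u')) hνΨ u
  -- Step 5: reparametrisation by `c⁻¹`
  have hc : MDifferentiableAt 𝓘(ℝ, E3) (𝓡 3) (chartAt E3 x₀).symm y :=
    (mdifferentiable_chart (I := 𝓡 3) x₀).mdifferentiableAt_symm hy.1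
  have hΨ : MDifferentiableAt 𝓘(ℝ, E3) (𝓡 3) Ψ u :=
    hc.comp u ((contMDiff_subtype_val (n := ∞)).mdifferentiableAt (by simp))
  have hΨd : mfderiv 𝓘(ℝ, E3) (𝓡 3) Ψ u = mfderiv 𝓘(ℝ, E3) (𝓡 3) (chartAt E3 x₀).symm y :=
    mfderiv_comp_subtypeVal (W := B') (f := (chartAt E3 x₀).symm) hc
  have h5 := PseudoRiemannianMetric.secondFundamentalForm_comp_right g (f := 𝒮.embed) (ν := 𝒮.normal)
    (Ψ := Ψ) (u := u) BoundarylessManifold.isInteriorPoint BoundarylessManifold.isInteriorPoint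
    (𝒮.mdifferentiableAt_embed_normal _) hΨ v w
  -- assemble
  have h3' : g₀.secondFundamentalForm 𝓘(ℝ, E3) f Nf u =
      g.secondFundamentalForm 𝓘(ℝ, E3) (𝒮.embed ∘ Ψ) (fun u' ↦ 𝒮.normal (Ψ u')) u := h3.trans h4
  have h6 : g.secondFundamentalForm (𝓡 3) 𝒮.embed 𝒮.normal (Ψ u) = D.kBilin (Ψ u) := 𝒮.induced_k (Ψ u)
  rw [h1, ← h2, h3', h5, h6, InitialDataSet.kBilin_apply, hΨd]
  rfl

end DataEmbedding

end Literature.Geometry.Lorentzian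

end
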